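/-
HONEST FRAMING: certified error envelopes and provably optimal rounding/accumulation schemes for
low-precision formats under stated cost models; every table by two implementations; no hardware
or vendor claims.
-/
import Mathlib.Data.Finsupp.Basic
import Summits.Ventures.CertifiedArithmetic.LowPrec.OptDemotionRouting

/-!
# The demotion law (Theorem T8), part 8f: routing COEFFICIENT VECTORS — the routing value is a maximum of linear forms in the weight

For the weighted routing value `treeBRw q W t S` of part 8a: a ROUTING of `S` through `t` (a
choice of valid split at every internal node) determines its COEFFICIENT VECTOR `G : ℤ →₀ ℚ`,
`G e` = the number of internal nodes whose configuration has top exponent `e`; its score at the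
weight `W` is the linear form `Σ_e G e · W e`.  `IsCoef q t S G` says `G` is the coefficient vector
of some routing of `S` through `t` (defined by recursion on `t`, no routing object needed), and
* `score_le_treeBRw` — every routing scores at most the routing value, at EVERY weight;
* `exists_isCoef_score_eq` — for `W ≥ 0` and routable `S` some routing attains it.
So `W ↦ treeBRw q W t S` is the upper envelope of finitely many linear forms — opt gen 13's
"family form" (R17(a): `Score(R) = Σ_i b_i F_i(R)`; here `F_i = Σ_k u^k · G(e_i - kq)`), the
supporting-hyperplane tool behind opt's monotonicity (M) and midpoint-convexity (MC) surgeries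
(§4 of gen13/README), which evaluate ONE optimal routing at several weights.
-/

namespace Summit.Ventures.CertifiedArithmetic.LowPrec.Opt

open Literature.ComputerArithmetic.JeannerodRump2018
open Literature.ComputerArithmetic.JeannerodRump2018.SumTree

/-- The score of a coefficient vector at a weight: `Σ_e G e · W e`. -/
noncomputable def score (W : ℤ → ℚ) (G : ℤ →₀ ℚ) : ℚ := G.sum fun e c => c * W e

/-- The score is additive in the coefficient vector. -/
theorem score_add (W : ℤ → ℚ) (G H : ℤ →₀ ℚ) : score W (G + H) = score W G + score W H := by
  unfold score
  apply Finsupp.sum_add_index'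
  · intro e; simp
  · intro e a b; ring

/-- The score of one node with top `e₀`. -/
theorem score_single (W : ℤ → ℚ) (e₀ : ℤ) : score W (Finsupp.single e₀ 1) = W e₀ := by
  unfold score
  rw [Finsupp.sum_single_index] <;> simp

/-- The score of the empty routing. -/
@[simp] theorem score_zero (W : ℤ → ℚ) : score W 0 = 0 := by
  unfold score; simp

/-- `G` IS THE COEFFICIENT VECTOR OF A ROUTING of `S` through `t`: a leaf and the empty
configuration route nothing; at a node holding `S ≠ ∅` with top `e₀`, a valid split `(A, B)` is
chosen, the node counts one for `e₀`, and the children route `A` and `B`. -/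
def IsCoef (q : ℕ) : SumTree → Finset ℤ → (ℤ →₀ ℚ) → Prop
  | .leaf _, _, G => G = 0
  | .node a b, S, G =>
      if h : S.Nonempty then
        ∃ AB ∈ splits q S (S.max' h), ∃ Ga Gb : ℤ →₀ ℚ, IsCoef q a AB.1 Ga ∧ IsCoef q b AB.2 Gb ∧
          G = Finsupp.single (S.max' h) 1 + Ga + Gb
      else G = 0

/-- At a leaf only the zero vector. -/
theorem isCoef_leaf {q : ℕ} {x : ℚ} {S : Finset ℤ} {G : ℤ →₀ ℚ} :
    IsCoef q (.leaf x) S G ↔ G = 0 := by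
  simp [IsCoef]

/-- On the empty configuration only the zero vector. -/
theorem isCoef_empty {q : ℕ} {t : SumTree} {G : ℤ →₀ ℚ} : IsCoef q t ∅ G ↔ G = 0 := by
  cases t <;> simp [IsCoef]

/-- The node rule. -/
theorem isCoef_node {q : ℕ} {a b : SumTree} {S : Finset ℤ} (h : S.Nonempty) {G : ℤ →₀ ℚ} :
    IsCoef q (.node a b) S G ↔
      ∃ AB ∈ splits q S (S.max' h), ∃ Ga Gb : ℤ →₀ ℚ, IsCoef q a AB.1 Ga ∧ IsCoef q b AB.2 Gb ∧
        G = Finsupp.single (S.max' h) 1 + Ga + Gb := by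
  simp [IsCoef, h]

/-- EVERY ROUTING SCORES AT MOST THE ROUTING VALUE, at every weight. -/
theorem score_le_treeBRw {q : ℕ} (W : ℤ → ℚ) :
    ∀ (t : SumTree) (S : Finset ℤ) (G : ℤ →₀ ℚ), IsCoef q t S G → score W G ≤ treeBRw q W t S
  | .leaf _, S, G, hG => by
      rw [isCoef_leaf.1 hG, score_zero, treeBRw_leaf]
  | .node a b, S, G, hG => by
      by_cases h : S.Nonempty
      · obtain ⟨AB, hAB, Ga, Gb, hGa, hGb, rfl⟩ := (isCoef_node h).1 hG
        rw [score_add, score_add, score_single]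
        have ha := score_le_treeBRw W a AB.1 Ga hGa
        have hb := score_le_treeBRw W b AB.2 Gb hGb
        have := split_le_treeBRw_node (q := q) (W := W) (a := a) (b := b) h (A := AB.1) (B := AB.2) hAB
        linarith
      · rw [Finset.not_nonempty_iff_eq_empty.1 h] at hG ⊢
        rw [isCoef_empty.1 hG, score_zero, treeBRw_empty]

/-- SOME ROUTING ATTAINS THE ROUTING VALUE (`W ≥ 0`, `S` routable; `q ≥ 1`). -/
theorem exists_isCoef_score_eq {q : ℕ} {W : ℤ → ℚ} (hW : ∀ e, 0 ≤ W e) :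
    ∀ (t : SumTree) (S : Finset ℤ), Routable q S →
      ∃ G : ℤ →₀ ℚ, IsCoef q t S G ∧ score W G = treeBRw q W t S
  | .leaf _, S, _ => ⟨0, isCoef_leaf.2 rfl, by simp⟩
  | .node a b, S, hS => by
      by_cases h : S.Nonempty
      · -- an attained split (or the trivial split `(S, ∅)` when the best split scores 0)
        have hm0 : (S, (∅ : Finset ℤ)) ∈ splits q S (S.max' h) :=
          mem_splits.2 ⟨Or.inl ⟨le_rfl, by simp⟩, hS, routable_empty q⟩
        obtain ⟨AB, hAB, hval⟩ : ∃ AB ∈ splits q S (S.max' h),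
            treeBRw q W (.node a b) S = W (S.max' h) + (treeBRw q W a AB.1 + treeBRw q W b AB.2) := by
          rcases treeBRw_node_eq (q := q) (W := W) (a := a) (b := b) h with h0 | hex
          · refine ⟨(S, ∅), hm0, ?_⟩
            have hle := split_le_treeBRw_node (q := q) (W := W) (a := a) (b := b) h hm0
            have hnn := treeBRw_nonneg (q := q) hW a S
            simp only [treeBRw_empty, add_zero] at hle ⊢
            linarith
          · exact hex
        obtain ⟨-, -, -, -, hrA, hrB⟩ := of_mem_splits (A := AB.1) (B := AB.2) hAB
        obtain ⟨Ga, hGa, hsa⟩ := exists_isCoef_score_eq hW a AB.1 hrA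
        obtain ⟨Gb, hGb, hsb⟩ := exists_isCoef_score_eq hW b AB.2 hrB
        refine ⟨Finsupp.single (S.max' h) 1 + Ga + Gb, (isCoef_node h).2 ⟨AB, hAB, Ga, Gb, hGa, hGb, rfl⟩, ?_⟩
        rw [score_add, score_add, score_single, hsa, hsb, hval]; ring
      · rw [Finset.not_nonempty_iff_eq_empty.1 h]
        exact ⟨0, isCoef_empty.2 rfl, by simp⟩

/-- THE ROUTING VALUE IS THE UPPER ENVELOPE OF THE ROUTING SCORES (`W ≥ 0`, `S` routable): a
supporting routing at `W` bounds the value at every other weight `W'` from below. -/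
theorem exists_isCoef_support {q : ℕ} {W : ℤ → ℚ} (hW : ∀ e, 0 ≤ W e) (t : SumTree) {S : Finset ℤ}
    (hS : Routable q S) :
    ∃ G : ℤ →₀ ℚ, IsCoef q t S G ∧ score W G = treeBRw q W t S ∧
      ∀ W' : ℤ → ℚ, score W' G ≤ treeBRw q W' t S := by
  obtain ⟨G, hG, hs⟩ := exists_isCoef_score_eq hW t S hS
  exact ⟨G, hG, hs, fun W' => score_le_treeBRw W' t S G hG⟩

/-- Coefficient vectors are nonnegative. -/
theorem isCoef_nonneg {q : ℕ} :
    ∀ (t : SumTree) (S : Finset ℤ) (G : ℤ →₀ ℚ), IsCoef q t S G → ∀ e, 0 ≤ G e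
  | .leaf _, S, G, hG, e => by rw [isCoef_leaf.1 hG]; simp
  | .node a b, S, G, hG, e => by
      by_cases h : S.Nonempty
      · obtain ⟨AB, -, Ga, Gb, hGa, hGb, rfl⟩ := (isCoef_node h).1 hG
        simp only [Finsupp.coe_add, Pi.add_apply, Finsupp.single_apply]
        have ha := isCoef_nonneg a AB.1 Ga hGa e
        have hb := isCoef_nonneg b AB.2 Gb hGb e
        split_ifs <;> linarith
      · rw [Finset.not_nonempty_iff_eq_empty.1 h] at hG
        rw [isCoef_empty.1 hG]; simp

/-- Coefficient vectors are supported below the top of the configuration and on the exponents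
reachable from `S` by injections: every counted exponent is `e - kq` for some `e ∈ S`, `k ≥ 0`
(stated with a predicate closed under `e ↦ e - q`). -/
theorem isCoef_support {q : ℕ} {p : ℤ → Prop} (hp : ∀ e, p e → p (e - q)) :
    ∀ (t : SumTree) (S : Finset ℤ) (G : ℤ →₀ ℚ), IsCoef q t S G → (∀ e ∈ S, p e) →
      ∀ e, G e ≠ 0 → p e
  | .leaf _, S, G, hG, _, e, he => by rw [isCoef_leaf.1 hG] at he; simp at he
  | .node a b, S, G, hG, hS, e, he => by
      by_cases h : S.Nonempty
      · obtain ⟨AB, hAB, Ga, Gb, hGa, hGb, rfl⟩ := (isCoef_node h).1 hG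
        obtain ⟨hA, hB, -⟩ := of_mem_splits (A := AB.1) (B := AB.2) hAB
        have hins : ∀ e ∈ insert (S.max' h - q) S, p e := by
          intro x hx
          rcases Finset.mem_insert.1 hx with rfl | hx
          · exact hp _ (hS _ (Finset.max'_mem S h))
          · exact hS x hx
        simp only [Finsupp.coe_add, Pi.add_apply, Finsupp.single_apply] at he
        by_cases h1 : Ga e ≠ 0
        · exact isCoef_support hp a AB.1 Ga hGa (fun x hx => hins x (hA hx)) e h1
        by_cases h2 : Gb e ≠ 0
        · exact isCoef_support hp b AB.2 Gb hGb (fun x hx => hins x (hB hx)) e h2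
        rw [not_not.1 h1, not_not.1 h2, add_zero, add_zero] at he
        by_cases h3 : S.max' h = e
        · rw [← h3]; exact hS _ (Finset.max'_mem S h)
        · rw [if_neg h3] at he; exact absurd rfl he
      · rw [Finset.not_nonempty_iff_eq_empty.1 h] at hG
        rw [isCoef_empty.1 hG] at he; simp at he

end Summit.Ventures.CertifiedArithmetic.LowPrec.Opt
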